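import Literature.NumberTheory.LFunctions.WeilOddThetaVector
import Literature.NumberTheory.LFunctions.DeBruijnPhiSecondDeriv
import HarnessLib

/-!
# Smoothness of `Φ′ = weilThetaPhiDeriv` (crux OddBartaFloor, line Sketch, stub phiDerivSmooth)

The derivative `Φ′ = weilThetaPhiDeriv` of Riemann's kernel in Weil's additive variable is `C^∞`.
Indeed `weilThetaPhiDeriv t = deBruijnPhiDeriv (t/2)` and
`deBruijnPhiDeriv u = 30 E_{2,2}(2u) − 15 E_{1,1}(2u) − 8 E_{3,3}(2u)` with the building blocks
`E_{j,k} = expThetaMoment j k`, whose derivatives `E_{j,k}′ = (1/2 + 2j) E_{j,k} − 2 E_{j+1,k+1}`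
(`hasDerivAt_expThetaMoment`) stay in the same family. By induction on `n`, every `E_{j,k}` is `C^n`
(`contDiff_succ_iff_deriv`), hence `C^∞`, and so are the affine reparametrisations and linear
combinations making up `Φ′`.

Elementary real analysis; no published source needed. [folklore]
-/

set_option linter.dupNamespace false

noncomputable section

open Set MeasureTheory Filter Complex
open scoped Real Topology ComplexConjugate ArithmeticFunction.vonMangoldt ENNReal

namespace Summit.RiemannHypothesis.RiemannHypothesis.Theorems.OddBartaFloor

open Literature.NumberTheory.LFunctions

/-- Every building block `E_{j,k} = expThetaMoment j k` is `C^n` for every natural `n`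
(induction on `n`: `E_{j,k}′ = (1/2 + 2j) E_{j,k} − 2 E_{j+1,k+1}`). [folklore] -/
private theorem stub_phiDerivSmooth_expThetaMoment_nat (n : ℕ) :
    ∀ j k : ℕ, ContDiff ℝ n (expThetaMoment j k) := by
  induction n with
  | zero => intro j k; exact_mod_cast contDiff_zero.2 (continuous_expThetaMoment j k)
  | succ n ih =>
    intro j k
    have e : deriv (expThetaMoment j k) =
        fun u => (1 / 2 + 2 * j) * expThetaMoment j k u - 2 * expThetaMoment (j + 1) (k + 1) u :=
      funext fun u => (hasDerivAt_expThetaMoment j k u).deriv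
    rw [show ((n + 1 : ℕ) : WithTop ℕ∞) = (n : ℕ) + 1 by push_cast; rfl, contDiff_succ_iff_deriv]
    refine ⟨fun u => (hasDerivAt_expThetaMoment j k u).differentiableAt,
      fun h => absurd h (by simp), ?_⟩
    rw [e]
    exact (contDiff_const.mul (ih j k)).sub (contDiff_const.mul (ih (j + 1) (k + 1)))

/-- Every building block `E_{j,k} = expThetaMoment j k` is `C^∞`. [folklore] -/
private theorem stub_phiDerivSmooth_expThetaMoment (j k : ℕ) :
    ContDiff ℝ ((⊤ : ℕ∞) : WithTop ℕ∞) (expThetaMoment j k) :=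
  contDiff_infty.2 fun n => stub_phiDerivSmooth_expThetaMoment_nat n j k

/-- `Φ_RT′ = deBruijnPhiDeriv` is `C^∞`. [folklore] -/
private theorem stub_phiDerivSmooth_deBruijnPhiDeriv :
    ContDiff ℝ ((⊤ : ℕ∞) : WithTop ℕ∞) deBruijnPhiDeriv := by
  have h2 : ContDiff ℝ ((⊤ : ℕ∞) : WithTop ℕ∞) fun u : ℝ => 2 * u := contDiff_const.mul contDiff_id
  have hE : ∀ j k : ℕ, ContDiff ℝ ((⊤ : ℕ∞) : WithTop ℕ∞) fun u : ℝ => expThetaMoment j k (2 * u) :=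
    fun j k => (stub_phiDerivSmooth_expThetaMoment j k).comp h2
  have e : deBruijnPhiDeriv = fun u => 30 * expThetaMoment 2 2 (2 * u) -
      15 * expThetaMoment 1 1 (2 * u) - 8 * expThetaMoment 3 3 (2 * u) := rfl
  rw [e]
  exact ((contDiff_const.mul (hE 2 2)).sub (contDiff_const.mul (hE 1 1))).sub
    (contDiff_const.mul (hE 3 3))

/-- **`Φ′ = weilThetaPhiDeriv` is `C^∞`** (`Φ′(t) = Φ_RT′(t/2)` with `Φ_RT′` a finite combination of
the smooth building blocks `E_{j,k}(2·)`). [folklore] -/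
theorem stub_phiDerivSmooth : ContDiff ℝ ((⊤ : ℕ∞) : WithTop ℕ∞) weilThetaPhiDeriv := by
  have e : weilThetaPhiDeriv = fun t => deBruijnPhiDeriv (t / 2) := rfl
  rw [e]
  exact stub_phiDerivSmooth_deBruijnPhiDeriv.comp (contDiff_id.div_const 2)

end Summit.RiemannHypothesis.RiemannHypothesis.Theorems.OddBartaFloor

end
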